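import Mathlib
import HarnessLib

/-!
# Fischler's finiteness criterion for `𝒥(p)` — I: one-variable bounds for the Euler kernel

Topic `Literature/NumberTheory/Irrationality/Fischler2002`; proofs-only companion of `RhinViolaGroupsGeneral.lean`
(named fact `Jn_finite_iff`, Fischler's finiteness criterion for the `n`-fold integrals `𝒥(p)`) and of `FamilyJ.lean`
(`integralJ_finite_iff`, the case `n = 5`). Source: S. Fischler, « Formes linéaires en polyzêtas et intégrales
multiples », C. R. Acad. Sci. Paris Sér. I **335** (2002) 1–4 = arXiv:math/0202064 [Fischler2002Polyzetas], §3 p. 4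
(« Alors l'intégrale 𝒥(p) est finie si et seulement si on a a_k ≥ 0, b_k ≥ 0 et ρ_k ≤ a_{k−1} pour tout k »); proof in
S. Fischler, *Groupes de Rhin-Viola et intégrales multiples*, J. Théor. Nombres Bordeaux **15** (2003) 479–534
[Fischler2003RhinViola], §4.1 Proposition 13 (cell `pub-zeta5`, seat ct-1 g32, 2026-08-27).

HONEST FRAMING (cells pub-zeta5 / zeta5-irr): systematic search; no irrationality claim unless certified. Real analysis
only (estimates of one-variable integrals of non-negative functions); nothing about `ζ(5)`.

## Contents (the one-variable step of the criterion)
In `𝒥(p)` the last variable `x_n = t` enters through the EULER KERNEL `t^α (1−t)^β (1 − tδ)^{−γ}` with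
`δ = δ_{n−1}(x₁,…,x_{n−1}) ∈ (0,1)`. This file proves, for REAL exponents (`Real.rpow`) and as lower Lebesgue integrals
over `(0,1)`:
* `lintegral_eulerKernel_le` — UPPER bound `∫ ≤ C·(1−δ)^{−r}` for `α, β > −1`, `r ≥ 0`, `γ − β − 1 < r`;
* `lintegral_beta_lt_top` — finiteness of `∫₀¹ t^α(1−t)^β dt` for `α, β > −1`;
together with elementary `rpow` comparison lemmas on subintervals of `(0,1]` and positivity / measurability of the
kernel. The LOWER bound and the DIVERGENCE statements are in `EulerKernelLowerBoundsProofs.lean`. Theorems only, no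
definition, no new named fact.
-/

noncomputable section

namespace Literature.NumberTheory.Irrationality.Fischler2002

open MeasureTheory Set
open scoped ENNReal

namespace JnFinite

/-! ### Elementary `rpow` comparisons on subintervals of `(0,1]` -/

/-- For `0 < a ≤ x ≤ 1` and real `z`: `a^{|z|} ≤ x^z`. [cite: Fischler2003RhinViola, §4.1 Proposition 13 (one-variable estimates)] -/
theorem rpow_abs_le_rpow {a x z : ℝ} (ha : 0 < a) (hax : a ≤ x) (hx1 : x ≤ 1) : a ^ |z| ≤ x ^ z := by
  rcases le_or_gt 0 z with hz | hz
  · rw [abs_of_nonneg hz]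
    exact Real.rpow_le_rpow ha.le hax hz
  · rw [abs_of_neg hz]
    calc a ^ (-z) ≤ 1 := Real.rpow_le_one ha.le (hax.trans hx1) (by linarith)
      _ ≤ x ^ z := Real.one_le_rpow_of_pos_of_le_one_of_nonpos (lt_of_lt_of_le ha hax) hx1 hz.le

/-- For `0 < a ≤ x ≤ 1` and real `z`: `x^z ≤ a^{−|z|}`. [cite: Fischler2003RhinViola, §4.1 Proposition 13 (one-variable estimates)] -/
theorem rpow_le_rpow_neg_abs {a x z : ℝ} (ha : 0 < a) (hax : a ≤ x) (hx1 : x ≤ 1) : x ^ z ≤ a ^ (-|z|) := by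
  rcases le_or_gt 0 z with hz | hz
  · rw [abs_of_nonneg hz]
    calc x ^ z ≤ 1 := Real.rpow_le_one (ha.le.trans hax) hx1 hz
      _ ≤ a ^ (-z) := Real.one_le_rpow_of_pos_of_le_one_of_nonpos ha (hax.trans hx1) (by linarith)
  · rw [abs_of_neg hz, neg_neg]
    exact Real.rpow_le_rpow_of_nonpos ha hax hz.le

/-- `(1/2)^w = 2^{−w}`. [cite: Fischler2003RhinViola, §4.1 Proposition 13 (one-variable estimates)] -/
theorem half_rpow (w : ℝ) : (1 / 2 : ℝ) ^ w = (2 : ℝ) ^ (-w) := by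
  rw [one_div, Real.inv_rpow (by norm_num : (0 : ℝ) ≤ 2), Real.rpow_neg (by norm_num : (0 : ℝ) ≤ 2)]

/-- For `1/2 ≤ x ≤ 1`: `2^{−|z|} ≤ x^z`. [cite: Fischler2003RhinViola, §4.1 Proposition 13 (one-variable estimates)] -/
theorem two_rpow_neg_abs_le {x z : ℝ} (hx : 1 / 2 ≤ x) (hx1 : x ≤ 1) : (2 : ℝ) ^ (-|z|) ≤ x ^ z := by
  have h := rpow_abs_le_rpow (z := z) (by norm_num : (0 : ℝ) < 1 / 2) hx hx1
  rwa [half_rpow] at h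

/-- For `1/2 ≤ x ≤ 1`: `x^z ≤ 2^{|z|}`. [cite: Fischler2003RhinViola, §4.1 Proposition 13 (one-variable estimates)] -/
theorem rpow_le_two_rpow_abs {x z : ℝ} (hx : 1 / 2 ≤ x) (hx1 : x ≤ 1) : x ^ z ≤ (2 : ℝ) ^ |z| := by
  have h := rpow_le_rpow_neg_abs (z := z) (by norm_num : (0 : ℝ) < 1 / 2) hx hx1
  rwa [half_rpow, neg_neg] at h

/-! ### The Euler kernel `t^α (1−t)^β (1 − tδ)^{−γ}`: positivity and measurability -/

/-- `1 − tδ ∈ [1−δ, 1]`, in particular `> 0`, for `t ∈ [0,1]`, `δ ∈ [0,1)`. [cite: Fischler2003RhinViola, §4.1 Proposition 13 (one-variable estimates)] -/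
theorem one_sub_mul_mem {t δ : ℝ} (ht0 : 0 ≤ t) (ht1 : t ≤ 1) (hδ0 : 0 ≤ δ) (hδ1 : δ < 1) :
    1 - δ ≤ 1 - t * δ ∧ 1 - t * δ ≤ 1 ∧ 0 < 1 - t * δ := by
  refine ⟨?_, ?_, ?_⟩
  · nlinarith [mul_le_mul_of_nonneg_right ht1 hδ0]
  · nlinarith [mul_nonneg ht0 hδ0]
  · nlinarith [mul_le_mul_of_nonneg_right ht1 hδ0]

/-- The Euler kernel is positive on `(0,1)` for `δ ∈ [0,1)`. [cite: Fischler2003RhinViola, §4.1 Proposition 13 (one-variable estimates)] -/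
theorem eulerKernel_pos {α β γ δ t : ℝ} (ht : t ∈ Ioo (0 : ℝ) 1) (hδ0 : 0 ≤ δ) (hδ1 : δ < 1) :
    0 < t ^ α * (1 - t) ^ β * (1 - t * δ) ^ (-γ) := by
  obtain ⟨-, -, h3⟩ := one_sub_mul_mem ht.1.le ht.2.le hδ0 hδ1
  have h1 : 0 < 1 - t := by linarith [ht.2]
  exact mul_pos (mul_pos (Real.rpow_pos_of_pos ht.1 _) (Real.rpow_pos_of_pos h1 _)) (Real.rpow_pos_of_pos h3 _)

/-- The Euler kernel is a measurable function of `t`. [cite: Fischler2003RhinViola, §4.1 Proposition 13 (one-variable estimates)] -/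
theorem measurable_eulerKernel (α β γ δ : ℝ) :
    Measurable fun t : ℝ => t ^ α * (1 - t) ^ β * (1 - t * δ) ^ (-γ) := by
  refine ((measurable_id.pow_const α).mul ((measurable_const.sub measurable_id).pow_const β)).mul
    ((measurable_const.sub (measurable_id.mul measurable_const)).pow_const (-γ))

/-! ### Finiteness of the Beta-type integral `∫₀¹ t^α (1−t)^β dt` -/

/-- `∫⁻_{(0,1)} ofReal(t^α) < ∞` for `α > −1`. [cite: Fischler2003RhinViola, §4.1 Proposition 13 (one-variable estimates)] -/
theorem lintegral_rpow_lt_top {α : ℝ} (hα : -1 < α) :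
    ∫⁻ t in Ioo (0 : ℝ) 1, ENNReal.ofReal (t ^ α) < ∞ := by
  have hint : IntegrableOn (fun t : ℝ => t ^ α) (Ioo (0 : ℝ) 1) := (intervalIntegral.integrableOn_Ioo_rpow_iff one_pos).2 hα
  have hnn : 0 ≤ᵐ[volume.restrict (Ioo (0 : ℝ) 1)] fun t : ℝ => t ^ α :=
    (ae_restrict_iff' measurableSet_Ioo).2 (Filter.Eventually.of_forall fun t ht => Real.rpow_nonneg ht.1.le _)
  exact (hasFiniteIntegral_iff_ofReal hnn).1 hint.hasFiniteIntegral

/-- `∫⁻_{(0,1)} ofReal((1−t)^β) < ∞` for `β > −1`. [cite: Fischler2003RhinViola, §4.1 Proposition 13 (one-variable estimates)] -/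
theorem lintegral_one_sub_rpow_lt_top {β : ℝ} (hβ : -1 < β) :
    ∫⁻ t in Ioo (0 : ℝ) 1, ENNReal.ofReal ((1 - t) ^ β) < ∞ := by
  have h1 : IntervalIntegrable (fun t : ℝ => t ^ β) volume 0 1 := intervalIntegral.intervalIntegrable_rpow' hβ
  have h2 : IntervalIntegrable (fun t : ℝ => (1 - t) ^ β) volume (1 - 0) (1 - 1) := h1.comp_sub_left 1
  rw [sub_zero, sub_self] at h2
  have hint : IntegrableOn (fun t : ℝ => (1 - t) ^ β) (Ioo (0 : ℝ) 1) :=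
    (intervalIntegrable_iff_integrableOn_Ioo_of_le zero_le_one).1 h2.symm
  have hnn : 0 ≤ᵐ[volume.restrict (Ioo (0 : ℝ) 1)] fun t : ℝ => (1 - t) ^ β :=
    (ae_restrict_iff' measurableSet_Ioo).2
      (Filter.Eventually.of_forall fun t ht => Real.rpow_nonneg (by linarith [ht.2]) _)
  exact (hasFiniteIntegral_iff_ofReal hnn).1 hint.hasFiniteIntegral

/-- **Beta finiteness**: `∫⁻_{(0,1)} ofReal(t^α (1−t)^β) < ∞` for `α, β > −1` (split at `t = 1/2`:
`t^α(1−t)^β ≤ 2^{|β|}t^α + 2^{|α|}(1−t)^β`). [cite: Fischler2003RhinViola, §4.1 Proposition 13 (one-variable estimates)] -/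
theorem lintegral_beta_lt_top {α β : ℝ} (hα : -1 < α) (hβ : -1 < β) :
    ∫⁻ t in Ioo (0 : ℝ) 1, ENNReal.ofReal (t ^ α * (1 - t) ^ β) < ∞ := by
  have hpt : ∀ t ∈ Ioo (0 : ℝ) 1,
      ENNReal.ofReal (t ^ α * (1 - t) ^ β) ≤
        ENNReal.ofReal ((2 : ℝ) ^ |β| * t ^ α) + ENNReal.ofReal ((2 : ℝ) ^ |α| * (1 - t) ^ β) := by
    intro t ht
    have ht0 := ht.1
    have h1t : 0 < 1 - t := by linarith [ht.2]
    have hA : 0 ≤ (2 : ℝ) ^ |β| * t ^ α := by positivity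
    have hB : 0 ≤ (2 : ℝ) ^ |α| * (1 - t) ^ β := by positivity
    rw [← ENNReal.ofReal_add hA hB]
    refine ENNReal.ofReal_le_ofReal ?_
    rcases le_or_gt t (1 / 2) with h | h
    · have hb : (1 - t) ^ β ≤ (2 : ℝ) ^ |β| := rpow_le_two_rpow_abs (by linarith) (by linarith)
      have : t ^ α * (1 - t) ^ β ≤ (2 : ℝ) ^ |β| * t ^ α := by
        rw [mul_comm]
        exact mul_le_mul_of_nonneg_right hb (Real.rpow_nonneg ht0.le _)
      linarith
    · have ha : t ^ α ≤ (2 : ℝ) ^ |α| := rpow_le_two_rpow_abs h.le ht.2.le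
      have : t ^ α * (1 - t) ^ β ≤ (2 : ℝ) ^ |α| * (1 - t) ^ β :=
        mul_le_mul_of_nonneg_right ha (Real.rpow_nonneg h1t.le _)
      linarith
  calc ∫⁻ t in Ioo (0 : ℝ) 1, ENNReal.ofReal (t ^ α * (1 - t) ^ β)
      ≤ ∫⁻ t in Ioo (0 : ℝ) 1, (ENNReal.ofReal ((2 : ℝ) ^ |β| * t ^ α) +
          ENNReal.ofReal ((2 : ℝ) ^ |α| * (1 - t) ^ β)) := setLIntegral_mono' measurableSet_Ioo hpt
    _ = (∫⁻ t in Ioo (0 : ℝ) 1, ENNReal.ofReal ((2 : ℝ) ^ |β| * t ^ α)) +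
          ∫⁻ t in Ioo (0 : ℝ) 1, ENNReal.ofReal ((2 : ℝ) ^ |α| * (1 - t) ^ β) := by
        refine lintegral_add_left ?_ _
        exact ((measurable_const.mul (measurable_id.pow_const α)).ennreal_ofReal)
    _ < ∞ := by
        refine ENNReal.add_lt_top.2 ⟨?_, ?_⟩
        · have h2 : (0 : ℝ) ≤ (2 : ℝ) ^ |β| := by positivity
          simp only [ENNReal.ofReal_mul h2]
          rw [lintegral_const_mul' _ _ ENNReal.ofReal_ne_top]
          exact ENNReal.mul_lt_top ENNReal.ofReal_lt_top (lintegral_rpow_lt_top hα)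
        · have h2 : (0 : ℝ) ≤ (2 : ℝ) ^ |α| := by positivity
          simp only [ENNReal.ofReal_mul h2]
          rw [lintegral_const_mul' _ _ ENNReal.ofReal_ne_top]
          exact ENNReal.mul_lt_top ENNReal.ofReal_lt_top (lintegral_one_sub_rpow_lt_top hβ)

/-! ### Upper bound -/

/-- **Upper bound for the Euler kernel.** For `α, β > −1`, `r ≥ 0` and `γ − β − 1 < r` there is a finite constant
`C` with `∫₀¹ t^α(1−t)^β(1−tδ)^{−γ} dt ≤ C·(1−δ)^{−r}` for every `δ ∈ [0,1)` (for `γ ≤ 0` the kernel is at most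
`t^α(1−t)^β`; for `γ > 0` split `(1−tδ)^{−γ} ≤ (1−t)^{−s}(1−δ)^{−(γ−s)}` with `s = (γ−r)⁺ < β+1`).
[cite: Fischler2003RhinViola, §4.1 Proposition 13 (one-variable estimates)] -/
theorem lintegral_eulerKernel_le {α β γ r : ℝ} (hα : -1 < α) (hβ : -1 < β) (hr : 0 ≤ r) (hγ : γ - β - 1 < r) :
    ∃ C : ℝ≥0∞, C ≠ ∞ ∧ ∀ δ : ℝ, 0 ≤ δ → δ < 1 →
      ∫⁻ t in Ioo (0 : ℝ) 1, ENNReal.ofReal (t ^ α * (1 - t) ^ β * (1 - t * δ) ^ (-γ)) ≤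
        C * ENNReal.ofReal ((1 - δ) ^ (-r)) := by
  rcases le_or_gt γ 0 with hγ0 | hγ0
  · -- `γ ≤ 0`: the kernel is bounded by `t^α (1−t)^β`, and `(1−δ)^{−r} ≥ 1`
    refine ⟨∫⁻ t in Ioo (0 : ℝ) 1, ENNReal.ofReal (t ^ α * (1 - t) ^ β), (lintegral_beta_lt_top hα hβ).ne,
      fun δ hδ0 hδ1 => ?_⟩
    have hone : (1 : ℝ≥0∞) ≤ ENNReal.ofReal ((1 - δ) ^ (-r)) := by
      rw [← ENNReal.ofReal_one]
      exact ENNReal.ofReal_le_ofReal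
        (Real.one_le_rpow_of_pos_of_le_one_of_nonpos (by linarith) (by linarith) (by linarith))
    calc ∫⁻ t in Ioo (0 : ℝ) 1, ENNReal.ofReal (t ^ α * (1 - t) ^ β * (1 - t * δ) ^ (-γ))
        ≤ ∫⁻ t in Ioo (0 : ℝ) 1, ENNReal.ofReal (t ^ α * (1 - t) ^ β) := by
          refine setLIntegral_mono' measurableSet_Ioo fun t ht => ENNReal.ofReal_le_ofReal ?_
          obtain ⟨-, h2, h3⟩ := one_sub_mul_mem ht.1.le ht.2.le hδ0 hδ1
          have hk : (1 - t * δ) ^ (-γ) ≤ 1 := Real.rpow_le_one h3.le h2 (by linarith)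
          have hnn : 0 ≤ t ^ α * (1 - t) ^ β :=
            mul_nonneg (Real.rpow_nonneg ht.1.le _) (Real.rpow_nonneg (by linarith [ht.2]) _)
          calc t ^ α * (1 - t) ^ β * (1 - t * δ) ^ (-γ) ≤ t ^ α * (1 - t) ^ β * 1 :=
                mul_le_mul_of_nonneg_left hk hnn
            _ = t ^ α * (1 - t) ^ β := mul_one _
      _ ≤ (∫⁻ t in Ioo (0 : ℝ) 1, ENNReal.ofReal (t ^ α * (1 - t) ^ β)) * ENNReal.ofReal ((1 - δ) ^ (-r)) :=
          le_mul_of_one_le_right' hone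
  · -- `γ > 0`: split the kernel with `s = (γ − r)⁺`
    set s : ℝ := max (γ - r) 0 with hs
    have hs0 : 0 ≤ s := le_max_right _ _
    have hsγ : s ≤ γ := max_le (by linarith) hγ0.le
    have hγs : γ - s ≤ r := by
      have : γ - r ≤ s := le_max_left _ _
      linarith
    have hβs : -1 < β - s := by
      rcases le_or_gt (γ - r) 0 with h | h
      · rw [hs, max_eq_right h]; linarith
      · rw [hs, max_eq_left h.le]; linarith
    refine ⟨∫⁻ t in Ioo (0 : ℝ) 1, ENNReal.ofReal (t ^ α * (1 - t) ^ (β - s)),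
      (lintegral_beta_lt_top hα hβs).ne, fun δ hδ0 hδ1 => ?_⟩
    have h1δ : 0 < 1 - δ := by linarith
    -- pointwise bound
    have hpt : ∀ t ∈ Ioo (0 : ℝ) 1, t ^ α * (1 - t) ^ β * (1 - t * δ) ^ (-γ) ≤
        t ^ α * (1 - t) ^ (β - s) * (1 - δ) ^ (-(γ - s)) := by
      intro t ht
      obtain ⟨h1, h2, h3⟩ := one_sub_mul_mem ht.1.le ht.2.le hδ0 hδ1
      have h1t : 0 < 1 - t := by linarith [ht.2]
      have h1t' : 1 - t ≤ 1 - t * δ := by nlinarith [mul_le_mul_of_nonneg_left hδ1.le ht.1.le]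
      -- `(1 − tδ)^{−γ} = (1 − tδ)^{−s} (1 − tδ)^{−(γ−s)} ≤ (1−t)^{−s} (1−δ)^{−(γ−s)}`
      have hsplit : (1 - t * δ) ^ (-γ) = (1 - t * δ) ^ (-s) * (1 - t * δ) ^ (-(γ - s)) := by
        rw [← Real.rpow_add h3]; congr 1; ring
      have hA : (1 - t * δ) ^ (-s) ≤ (1 - t) ^ (-s) := Real.rpow_le_rpow_of_nonpos h1t h1t' (by linarith)
      have hB : (1 - t * δ) ^ (-(γ - s)) ≤ (1 - δ) ^ (-(γ - s)) :=
        Real.rpow_le_rpow_of_nonpos h1δ h1 (by linarith)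
      have hAB : (1 - t * δ) ^ (-γ) ≤ (1 - t) ^ (-s) * (1 - δ) ^ (-(γ - s)) := by
        rw [hsplit]
        exact mul_le_mul hA hB (Real.rpow_nonneg h3.le _) (Real.rpow_nonneg h1t.le _)
      have hnn : 0 ≤ t ^ α * (1 - t) ^ β :=
        mul_nonneg (Real.rpow_nonneg ht.1.le _) (Real.rpow_nonneg h1t.le _)
      calc t ^ α * (1 - t) ^ β * (1 - t * δ) ^ (-γ)
          ≤ t ^ α * (1 - t) ^ β * ((1 - t) ^ (-s) * (1 - δ) ^ (-(γ - s))) :=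
            mul_le_mul_of_nonneg_left hAB hnn
        _ = t ^ α * ((1 - t) ^ β * (1 - t) ^ (-s)) * (1 - δ) ^ (-(γ - s)) := by ring
        _ = t ^ α * (1 - t) ^ (β - s) * (1 - δ) ^ (-(γ - s)) := by
            rw [← Real.rpow_add h1t, show β + -s = β - s by ring]
    have hδpow : ENNReal.ofReal ((1 - δ) ^ (-(γ - s))) ≤ ENNReal.ofReal ((1 - δ) ^ (-r)) :=
      ENNReal.ofReal_le_ofReal (Real.rpow_le_rpow_of_exponent_ge h1δ (by linarith) (by linarith))
    have hc0 : 0 ≤ (1 - δ) ^ (-(γ - s)) := Real.rpow_nonneg h1δ.le _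
    calc ∫⁻ t in Ioo (0 : ℝ) 1, ENNReal.ofReal (t ^ α * (1 - t) ^ β * (1 - t * δ) ^ (-γ))
        ≤ ∫⁻ t in Ioo (0 : ℝ) 1, ENNReal.ofReal (t ^ α * (1 - t) ^ (β - s) * (1 - δ) ^ (-(γ - s))) :=
          setLIntegral_mono' measurableSet_Ioo fun t ht => ENNReal.ofReal_le_ofReal (hpt t ht)
      _ = (∫⁻ t in Ioo (0 : ℝ) 1, ENNReal.ofReal (t ^ α * (1 - t) ^ (β - s))) *
            ENNReal.ofReal ((1 - δ) ^ (-(γ - s))) := by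
          have : ∀ t : ℝ, ENNReal.ofReal (t ^ α * (1 - t) ^ (β - s) * (1 - δ) ^ (-(γ - s))) =
              ENNReal.ofReal ((1 - δ) ^ (-(γ - s))) * ENNReal.ofReal (t ^ α * (1 - t) ^ (β - s)) := by
            intro t; rw [mul_comm (t ^ α * (1 - t) ^ (β - s)), ENNReal.ofReal_mul hc0]
          simp only [this]
          rw [lintegral_const_mul' _ _ ENNReal.ofReal_ne_top, mul_comm]
      _ ≤ (∫⁻ t in Ioo (0 : ℝ) 1, ENNReal.ofReal (t ^ α * (1 - t) ^ (β - s))) *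
            ENNReal.ofReal ((1 - δ) ^ (-r)) := mul_le_mul' le_rfl hδpow

end JnFinite

end Literature.NumberTheory.Irrationality.Fischler2002

end
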